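import Summits.Ventures.HodgeRepro.CongruenceHermitianSubmersion
import Summits.Ventures.HodgeRepro.BallDominance

/-!
# R5 with its dominance clause: the rational translates make `𝔹^p → ℂ^p` Zariski-dominant (seat p5)

Blind re-derivation cell `pub-hodge-repro`, seat `p5`.  The theorem of `CongruenceHermitianSubmersion.lean`
(R5 steps (2)–(4), local form, on the rational points of any Hermitian form of signature `(p,1)`) produces
rational translates `γ_1, …, γ_p` for which `w ↦ (h_l(γ_l w))_l` is a submersion on an open dense set of the
ball.  `BallDominance.lean` turns ONE such point into the global statement of ROUTE-C 13.3(iv): the image of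
the ball under `w ↦ (h_l(γ_l w))_l` is a set of uniqueness for entire functions on `ℂ^p` — every entire
`H : ℂ^p → ℂ` vanishing on it is `0`.  Read on `A′ = ℂ^p / Λ` (the lift of `f : S′ → A′`, the `h_l` the lifts
of the Albanese coordinates, `A′` of dimension `g′ = p` after 13.4(a)'s choice of `p`, or with `p` replaced by
`g′ ≤ p` forms): `f(S′)` lies in the zero locus of no non-zero theta function, i.e. in no divisor of `A′`, so
`f(S′)` is Zariski dense and `f` is dominant — the clause R7 needs.

* **`lemmaW_dominance_congruenceCover_ratPointsOf`** — for `Γ(M) ≤ Γ′ ≤ U(H_K)(𝓞_K)`, `M ≠ 0`, transported to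
  `U(p,1)`, and `p` functions `h_l` analytic near the ball, none locally constant on it, with `Γ′`-invariant
  `dh_l`, there are rational `γ_1, …, γ_p ∈ ratPointsOf` such that (i) every entire `H : ℂ^p → ℂ` vanishing on
  `{(h_l(γ_l w))_l : w ∈ 𝔹^p}` is identically zero, (ii) `⋀_l γ_l^*(dh_l)` is `Γ″`-invariant,
  (iii) `Γ″ ⊇ toUp(Γ(L))` for some `L ≠ 0`, (iv) `Γ″` has finite index in `Γ′`.

What stays on paper: 13.2(a) (the eigenforms ARE the `dh_l` of the Albanese coordinates), 13.2(c)
(components), and the textbook sentence that a proper closed subvariety of the projective `A′` lies in a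
divisor (the zero locus of a theta function — an entire function on `ℂ^p`).

Nothing here says anything about the status of the Hodge conjecture for CM abelian varieties.
-/

set_option autoImplicit false

noncomputable section

namespace Summit.Ventures.HodgeRepro

namespace CongHerm

open Matrix Filter Topology
open NumberField
open HodgeRepro.BallGen (Idx GLp U Ball unitaryGroupOf ratPointsOf pullback center)
open HodgeRepro.BallGen.Inv (IsInvariant IsInvariantTop topForm)
open HodgeRepro.BallGen.Holo (ballSet actE isOpen_ballSet)
open HodgeRepro.BallGen.Subm (dcov)
open HodgeRepro.BallGen.Dom (eq_zero_of_eqOn_image_of_mem_nhds)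
open CongGen

variable {p : ℕ} {K : Type} [Field K] [NumberField K] [IsCMField K]
variable (HK : Matrix (Idx p) (Idx p) K) (φ₀ : K →+* ℂ) (P : GLp p)
  (hP : (P : Matrix (Idx p) (Idx p) ℂ)ᴴ * HK.map φ₀ * (P : Matrix (Idx p) (Idx p) ℂ) = HodgeRepro.BallGen.J p)

/-- **R5 with the dominance clause, on the rational points of an arbitrary Hermitian form of signature
`(p,1)` over a CM field.**  Let `Γ(M) ≤ Γ′ ≤ U(H_K)(𝓞_K)`, `M ≠ 0`, be transported to `U(p,1)` by `toUp`, and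
let `h_1, …, h_p` be analytic on a neighbourhood of the ball, none locally constant on it, with `Γ′`-invariant
differential covector fields `dh_l`.  Then there are rational `γ_1, …, γ_p ∈ ratPointsOf` such that: every
entire function `H : ℂ^p → ℂ` that vanishes at every point `(h_l(γ_l w))_l`, `w ∈ 𝔹^p`, is identically zero
(the image of the ball is Zariski dense — `f` is dominant); the `(p,0)`-form `⋀_l γ_l^*(dh_l)` is invariant
under `Γ″ = Γ′ ⊓ ⨅_l γ_l⁻¹ Γ′ γ_l`; `Γ″` contains the transported principal congruence subgroup `Γ(L)` for some
`L ≠ 0`; and `Γ″` has finite index in `Γ′`. -/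
theorem lemmaW_dominance_congruenceCover_ratPointsOf {Γ' : Subgroup (unitaryGroupOf HK)}
    (hΓ : Γ' ≤ arithU HK) {M : 𝓞 K} (hM0 : M ≠ 0) (hM : congrU HK M ≤ Γ')
    {h : Fin p → (Fin p → ℂ) → ℂ} (hh : ∀ l, AnalyticOnNhd ℂ (h l) (ballSet p))
    (hh0 : ∀ l, ∃ w : Ball p, dcov (h l) w.1 ≠ 0)
    (hhΓ : ∀ l, IsInvariant (Γ'.map (toUp HK φ₀ P hP)) fun w : Ball p => dcov (h l) w.1) :
    ∃ γ : Fin p → U p, (∀ l, γ l ∈ ratPointsOf φ₀ HK P hP) ∧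
      (∀ H : (Fin p → ℂ) → ℂ, AnalyticOnNhd ℂ H Set.univ →
        (∀ w ∈ ballSet p, H (fun l => h l (actE (γ l) w)) = 0) → H = 0) ∧
      IsInvariantTop (Γ'.map (toUp HK φ₀ P hP) ⊓ ⨅ l, conjSubG (γ l) (Γ'.map (toUp HK φ₀ P hP)))
        (topForm fun l => pullback (γ l) fun w : Ball p => dcov (h l) w.1) ∧
      (∃ L : 𝓞 K, L ≠ 0 ∧ (congrU HK L).map (toUp HK φ₀ P hP) ≤
        Γ'.map (toUp HK φ₀ P hP) ⊓ ⨅ l, conjSubG (γ l) (Γ'.map (toUp HK φ₀ P hP))) ∧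
      (Γ'.map (toUp HK φ₀ P hP) ⊓ ⨅ l, conjSubG (γ l) (Γ'.map (toUp HK φ₀ P hP))).IsFiniteRelIndex
        (Γ'.map (toUp HK φ₀ P hP)) := by
  obtain ⟨γ, hγ, ⟨S, _hSo, hSd, hsub⟩, hinv, hL, hfin⟩ :=
    lemmaW_submersion_congruenceCover_ratPointsOf HK φ₀ P hP hΓ hM0 hM hh hh0 hhΓ
  refine ⟨γ, hγ, fun H hH h0 => ?_, hinv, hL, hfin⟩
  haveI : Nonempty (Ball p) := ⟨center p⟩
  obtain ⟨z, hz⟩ := hSd.nonempty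
  exact eq_zero_of_eqOn_image_of_mem_nhds
    (hsub z hz (ballSet p) (isOpen_ballSet.mem_nhds (HodgeRepro.BallGen.Holo.val_mem_ballSet z))) hH h0

end CongHerm

end Summit.Ventures.HodgeRepro

end
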